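import Summits.Ventures.YMGap.Census.CharacterPowerExpansion
import Summits.Ventures.YMGap.Census.HypercubeExponentQuarter
import HarnessLib

/-!
# Venture YMGap, track (b) census — Tomboulis III.1's companion: the LOWER bound III.2 (3.7) on even tori,
# by App. A §3's two-line argument with the exponent the tree certifies

HONEST FRAMING: venture file of the cell `pub-ymgap` (QuantumFields programme).  Exact statements about the finite tori
`(ℤ/bLℤ)^d → (ℤ/Lℤ)^d`; nothing about (5.15), confinement or any limit.

Tomboulis (arXiv:0707.2179, Prop. III.2, eqs. (3.6)–(3.7); proof App. A §3) derives
`Z_{Λ^{(n)}}({c_j(n-1)^6}) ≤ Z_{Λ^{(n-1)}}({c_j(n-1)})` from II.1 (ii) in two lines: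
`Z_{Λ^{(n-1)}} ≥ [1 + Σ_j d_j² c_j^6]^{|Λ^{(n-1)}|} ≥ [1 + Σ_j d_j² c_j^6]^{|Λ^{(n)}|} ≥ ∫ ∏_{p ∈ Λ^{(n)}} [1 + Σ_j d_j c_j^6 χ_j(U_p)]`,
the last step being the sup bound `|χ_j| ≤ d_j`.  The only input is an instance of (2.13) on the FINE torus whose exponent is at least the
number of plaquettes of the COARSE torus.  The tree certifies (2.13) with exponent `(side)^d / 4` on every even torus in `d ≥ 3`
(`hypercubeLowerBoundExp_quarter`, from reflection positivity; the printed #sites exponent fails on `2³`, `not_hypercubeLowerBound_222_of_table`),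
so III.2 — the typed `Tomboulis2007.DecimationLowerBound d L b J`, for EVERY admissible coefficient vector, no positivity restriction on `f` —
is a tree theorem whenever `4 · #plaquettes((ℤ/Lℤ)^d) ≤ (bL)^d`, i.e. `2d(d-1) ≤ b^d`: every `b ≥ 3` in `d = 3, 4`, and `b = 2` from `d = 6` on
(`decimationLowerBound_of_le`); `b = 2` in `d = 3, 4, 5` is NOT covered by this exponent and is left open here.

* `abs_su2Char_le`, `abs_plaqFn_le`, `torusZ_le_pow_card` — the sup bound `Z_Λ({c_j}) ≤ [1 + Σ_j d_j² c_j]^{#plaquettes}` for `c_j ≥ 0`;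
* `two_mul_card_plaquette` — `2 · #plaquettes((ℤ/Lℤ)^d) = d(d-1) L^d`;
* `decimationLowerBound_of_exp` — III.2 from ANY instance `HypercubeLowerBoundExp d (bL) J m` with `#plaquettes((ℤ/Lℤ)^d) ≤ m` (T07's argument verbatim);
* `decimationLowerBound_of_four_mul_card_le`, `decimationLowerBound_of_le` — III.2 on even fine tori, `d ≥ 3`, under `4 · #plaquettes ≤ (bL)^d`
  resp. `2d(d-1) ≤ b^d`; instances `decimationLowerBound_three` (`d = 3, 4`, `b = 3`, `L` even).
[cite: Tomboulis2007Confinement, Prop. III.2 eqs. (3.6)–(3.7); App. A §3]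
-/

noncomputable section

open MeasureTheory Finset Real Polynomial.Chebyshev
open scoped BigOperators
open Literature.MathematicalPhysics.QuantumLattice
open Literature.MathematicalPhysics.QuantumFieldTheory
open Literature.MathematicalPhysics.QuantumFieldTheory.Tomboulis2007
open Summit.Ventures.LatticeQCDFlow.Exactness
open Summit.Ventures.LatticeQCDFlow.Scoring

namespace Summit.Ventures.YMGap.Census

variable {d L : ℕ} [NeZero L]

/-! ### The sup bound -/

/-- `|χ_j(U)| ≤ d_j = 2j + 1` (Abramowitz–Stegun 22.14.6 at `a₀(U) ∈ [-1, 1]`). [folklore] -/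
theorem abs_su2Char_le (n : ℕ) (g : SU2) : |su2Char n g| ≤ (n : ℝ) + 1 :=
  abs_chebyshevU_eval_le n (abs_su2a0_le_one g)

/-- `|f(U)| ≤ 1 + Σ_j d_j² c_j` for `c_j ≥ 0`. [folklore] -/
theorem abs_plaqFn_le (J : ℕ) {c : ℕ → ℝ} (hc : ∀ n, 1 ≤ n → 0 ≤ c n) (g : SU2) :
    |plaqFn J c g| ≤ 1 + ∑ n ∈ Icc 1 J, ((n : ℝ) + 1) ^ 2 * c n := by
  unfold plaqFn
  have hs : |∑ n ∈ Icc 1 J, ((n : ℝ) + 1) * c n * su2Char n g| ≤ ∑ n ∈ Icc 1 J, ((n : ℝ) + 1) ^ 2 * c n := by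
    refine (abs_sum_le_sum_abs _ _).trans (sum_le_sum fun n hn => ?_)
    have hn0 : 0 ≤ c n := hc n (mem_Icc.1 hn).1
    rw [abs_mul, abs_mul, abs_of_nonneg (by positivity : (0 : ℝ) ≤ (n : ℝ) + 1), abs_of_nonneg hn0]
    calc ((n : ℝ) + 1) * c n * |su2Char n g| ≤ ((n : ℝ) + 1) * c n * ((n : ℝ) + 1) :=
          mul_le_mul_of_nonneg_left (abs_su2Char_le n g) (by positivity)
      _ = ((n : ℝ) + 1) ^ 2 * c n := by ring
  have h1 := abs_add_le (1 : ℝ) (∑ n ∈ Icc 1 J, ((n : ℝ) + 1) * c n * su2Char n g)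
  rw [abs_one] at h1
  linarith

/-- **The sup bound** `Z_Λ({c_j}) ≤ [1 + Σ_j d_j² c_j]^{#plaquettes}` for `c_j ≥ 0` (App. A §3, last step of the III.2 chain). [folklore] -/
theorem torusZ_le_pow_card (J : ℕ) {c : ℕ → ℝ} (hc : ∀ n, 1 ≤ n → 0 ≤ c n) :
    torusZ d L J c ≤ (1 + ∑ n ∈ Icc 1 J, ((n : ℝ) + 1) ^ 2 * c n) ^ Fintype.card (Plaquette d L) := by
  unfold torusZ
  refine (le_abs_self _).trans ?_
  have h := norm_integral_le_of_norm_le_const (μ := Measure.pi fun _ : Edge d L => haarProbability SU2)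
    (f := fun U : Edge d L → SU2 => ∏ p : Plaquette d L, plaqFn J c (plaquetteHolonomy U p.1 p.2.1.1 p.2.1.2))
    (C := (1 + ∑ n ∈ Icc 1 J, ((n : ℝ) + 1) ^ 2 * c n) ^ Fintype.card (Plaquette d L))
    (Filter.Eventually.of_forall fun U => ?_)
  · simpa using h
  · rw [Real.norm_eq_abs, Finset.abs_prod, ← Finset.card_univ, ← Finset.prod_const]
    exact prod_le_prod (fun _ _ => abs_nonneg _) fun p _ => abs_plaqFn_le J hc _

/-! ### Counting plaquettes -/

/-- The number of plane orientations `i < j` in `d` dimensions, doubled: `2 · #{(i,j) : i < j} = d(d-1)`. [folklore] -/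
theorem two_mul_card_dirPairs : 2 * Fintype.card {p : Fin d × Fin d // p.1 < p.2} = d * (d - 1) := by
  have hlt : Fintype.card {p : Fin d × Fin d // p.1 < p.2} = (univ.filter fun p : Fin d × Fin d => p.1 < p.2).card :=
    Fintype.card_subtype _
  have hgt : Fintype.card {p : Fin d × Fin d // p.1 < p.2} = (univ.filter fun p : Fin d × Fin d => p.2 < p.1).card := by
    rw [hlt]
    refine card_bij (fun p _ => (p.2, p.1)) (fun p hp => by simpa using hp) (fun p _ q _ h => ?_) (fun q hq => ⟨(q.2, q.1), by simpa using hq, rfl⟩)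
    simp only [Prod.mk.injEq] at h
    exact Prod.ext h.2 h.1
  have hoff : (univ.filter fun p : Fin d × Fin d => p.1 < p.2).card + (univ.filter fun p : Fin d × Fin d => p.2 < p.1).card =
      (univ.filter fun p : Fin d × Fin d => p.1 ≠ p.2).card := by
    rw [← card_union_of_disjoint]
    · congr 1
      ext p
      simp only [mem_union, mem_filter, mem_univ, true_and]
      exact lt_or_lt_iff_ne
    · rw [disjoint_filter]
      intro p _ h1 h2
      exact lt_asymm h1 h2
  have hne : (univ.filter fun p : Fin d × Fin d => p.1 ≠ p.2).card = d * d - d := by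
    have h1 : (univ.filter fun p : Fin d × Fin d => p.1 = p.2).card = d := by
      rw [show (univ.filter fun p : Fin d × Fin d => p.1 = p.2) = (univ : Finset (Fin d)).map ⟨fun i => (i, i), fun i j h => by simpa using h⟩ by
        ext p
        simp only [mem_filter, mem_univ, true_and, mem_map, Function.Embedding.coeFn_mk]
        constructor
        · intro h; exact ⟨p.1, by ext <;> simp [h]⟩
        · rintro ⟨i, rfl⟩; rfl]
      simp
    have h2 := card_filter_add_card_filter_not (s := (univ : Finset (Fin d × Fin d))) (fun p : Fin d × Fin d => p.1 = p.2)
    rw [h1, card_univ, Fintype.card_prod, Fintype.card_fin] at h2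
    have h3 : (univ.filter fun p : Fin d × Fin d => ¬p.1 = p.2) = (univ.filter fun p : Fin d × Fin d => p.1 ≠ p.2) := rfl
    rw [h3] at h2
    omega
  have hsq : d * d - d = d * (d - 1) := (Nat.mul_sub_one d d).symm
  omega

/-- `2 · #plaquettes((ℤ/Lℤ)^d) = d(d-1) L^d`. [folklore] -/
theorem two_mul_card_plaquette : 2 * Fintype.card (Plaquette d L) = d * (d - 1) * L ^ d := by
  rw [Fintype.card_prod, Fintype.card_fun, ZMod.card, Fintype.card_fin, mul_comm (L ^ d), ← mul_assoc, two_mul_card_dirPairs]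

/-! ### III.2 -/

/-- The base of (2.13) is at least `1`. [folklore] -/
theorem one_le_hypercubeBase (J : ℕ) (c : ℕ → ℝ) : (1 : ℝ) ≤ 1 + ∑ n ∈ Icc 1 J, ((n : ℝ) + 1) ^ 2 * c n ^ 6 :=
  le_add_of_nonneg_right (sum_nonneg fun n _ => by positivity)

/-- **III.2 from (2.13) — App. A §3 verbatim**: any instance of (2.13) on the fine torus `(ℤ/bLℤ)^d` whose exponent is at least the number of
plaquettes of the coarse torus `(ℤ/Lℤ)^d` gives `Z_{(ℤ/Lℤ)^d}({c_j^6}) ≤ Z_{(ℤ/bLℤ)^d}({c_j})` for every admissible `{c_j}`.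
[cite: Tomboulis2007Confinement, Prop. III.2 eq. (3.7); App. A §3] -/
theorem decimationLowerBound_of_exp (b J : ℕ) [NeZero (b * L)] {m : ℕ} (h : HypercubeLowerBoundExp d (b * L) J m)
    (hm : Fintype.card (Plaquette d L) ≤ m) : DecimationLowerBound d L b J := by
  intro c hc
  have hc6 : ∀ n, 1 ≤ n → 0 ≤ lowerCoeff c n := fun n hn => pow_nonneg (hc n hn).1 6
  calc torusZ d L J (lowerCoeff c)
      ≤ (1 + ∑ n ∈ Icc 1 J, ((n : ℝ) + 1) ^ 2 * lowerCoeff c n) ^ Fintype.card (Plaquette d L) := torusZ_le_pow_card J hc6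
    _ = (1 + ∑ n ∈ Icc 1 J, ((n : ℝ) + 1) ^ 2 * c n ^ 6) ^ Fintype.card (Plaquette d L) := rfl
    _ ≤ (1 + ∑ n ∈ Icc 1 J, ((n : ℝ) + 1) ^ 2 * c n ^ 6) ^ m := pow_le_pow_right₀ (one_le_hypercubeBase J c) hm
    _ ≤ torusZ d (b * L) J c := h c hc

/-- **III.2 on even fine tori, `d ≥ 3`, whenever `4 · #plaquettes((ℤ/Lℤ)^d) ≤ (bL)^d`** — from the tree's quarter-exponent instance of (2.13)
(`hypercubeLowerBoundExp_quarter`). [cite: Tomboulis2007Confinement, Prop. III.2 eq. (3.7)] -/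
theorem decimationLowerBound_of_four_mul_card_le (hd : 3 ≤ d) (b J : ℕ) [NeZero (b * L)] (hbL : Even (b * L))
    (hm : 4 * Fintype.card (Plaquette d L) ≤ (b * L) ^ d) : DecimationLowerBound d L b J :=
  decimationLowerBound_of_exp b J (hypercubeLowerBoundExp_of_le_quarter hd hbL ((Nat.le_div_iff_mul_le (by norm_num)).2 (by simpa [mul_comm] using hm)))
    le_rfl

/-- **III.2 for `2d(d-1) ≤ b^d`** (every `b ≥ 3` in `d = 3, 4`; `b = 2` needs `d ≥ 6`), fine torus even, every `J`, every admissible `{c_j}`.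
[cite: Tomboulis2007Confinement, Prop. III.2 eq. (3.7)] -/
theorem decimationLowerBound_of_le (hd : 3 ≤ d) (b J : ℕ) [NeZero (b * L)] (hbL : Even (b * L)) (hb : 2 * (d * (d - 1)) ≤ b ^ d) :
    DecimationLowerBound d L b J := by
  refine decimationLowerBound_of_four_mul_card_le hd b J hbL ?_
  have h2 := two_mul_card_plaquette (d := d) (L := L)
  calc 4 * Fintype.card (Plaquette d L) = 2 * (d * (d - 1)) * L ^ d := by rw [show 4 = 2 * 2 from rfl, mul_assoc, h2, ← mul_assoc, ← mul_assoc]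
    _ ≤ b ^ d * L ^ d := Nat.mul_le_mul_right _ hb
    _ = (b * L) ^ d := (mul_pow b L d).symm

/-- Instance: **III.2 holds for `b = 3` in `d = 3` on every even torus.** [cite: Tomboulis2007Confinement, Prop. III.2 eq. (3.7)] -/
theorem decimationLowerBound_three_d3 (hL : Even L) (J : ℕ) : DecimationLowerBound 3 L 3 J :=
  haveI : NeZero (3 * L) := ⟨by have := NeZero.ne L; omega⟩
  decimationLowerBound_of_le (le_refl 3) 3 J (hL.mul_left 3) (by norm_num)

/-- Instance: **III.2 holds for `b = 3` in `d = 4` on every even torus.** [cite: Tomboulis2007Confinement, Prop. III.2 eq. (3.7)] -/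
theorem decimationLowerBound_three_d4 (hL : Even L) (J : ℕ) : DecimationLowerBound 4 L 3 J :=
  haveI : NeZero (3 * L) := ⟨by have := NeZero.ne L; omega⟩
  decimationLowerBound_of_le (by norm_num) 3 J (hL.mul_left 3) (by norm_num)

end Summit.Ventures.YMGap.Census
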